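import Mathlib
import HarnessLib
import Literature.Probability.MarkovChains.RandomScanGibbsAutocovariance

/-!
# Random-link heat bath for discrete link variables has non-negative, non-increasing
# autocovariances at every lag and never beats independent sampling

HONEST FRAMING: exact (Metropolis-corrected) sampling algorithms for lattice gauge theory; figures
of merit are autocorrelation/cost numbers at stated couplings and volumes; no continuum-physics claim.

Venture `LatticeQCDFlow` (cell pub-lqcd), topic `Scoring`; row 33 (`lit-codes`, literature-prover
seat GEN-42).  NEW WORK of the cell = the lattice SPECIALISATION of
`RandomScanGibbsAutocovariance.lean` (Liu 2001 §6.6.2 Lemma 6.6.1 / Thm 6.6.2, Liu–Wong–Kong 1995)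
in the setting of `MetropolizedHeatBath.lean` (same cell, same seat): `n ≥ 1` links with values in a finite `G`, ANY
positive Boltzmann weight `w` (unnormalised), Gibbs law `p = w/Z`, uniform random link choice,
`P_HB = randomScanGibbs (fun _ => 1/n) p`.  Nothing is cited as a fact; no definition.

* `heatBath_autocov_nonneg` — every stationary lag-`k` autocovariance of every observable is `≥ 0`:
  `C_f(k) = ⟨f̄, P_HBᵏ f̄⟩_p ≥ 0`;
* `heatBath_autocov_antitone` — and non-increasing in `k`: `C_f(k+1) ≤ C_f(k)`;
* `heatBath_eigenvalue_nonneg` — every real eigenvalue of `P_HB` is `≥ 0` (no negative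
  eigenvalue: for this dynamics `t_rel` is set by `λ₂`, never by `λ_min`);
* **`var_le_asympVar_heatBath`** — `var_p(f) ≤ v(f, p, P_HB)`: one random-link heat-bath update per
  step is never better than one independent draw from `p` per step, for any observable — the
  integrated autocorrelation time is at least `½`… in the normalisation `v = 2 τ_int var`, `τ_int ≥ ½`.

Consequence for the cell's bookkeeping (no number of ours involved): a NEGATIVE measured lag-1
autocovariance on a run labelled "random-link heat bath, discrete links" contradicts
`heatBath_autocov_nonneg` and flags a labelling or measurement error; sweep (systematic-scan) heat
bath is NOT covered (not reversible in general).

NOT CLAIMED: continuous gauge groups; systematic scans; the Metropolized heat bath (its forward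
operator is NOT positive in general — for `|G| = 2` it is the Metropolis flip, which can have
negative eigenvalues); any rate.
-/

namespace Summit.Ventures.LatticeQCDFlow.Scoring

open Finset Function Matrix Literature.Probability.MarkovChains

variable {n : ℕ} {G : Type*} [Fintype G] [DecidableEq G] {w : (Fin n → G) → ℝ}

omit [DecidableEq G] in
/-- The Gibbs law is positive. -/
private theorem gibbs_pos' (hw : ∀ U, 0 < w U) (U : Fin n → G) : 0 < w U / ∑ V, w V :=
  div_pos (hw U) (sum_pos (fun V _ => hw V) ⟨U, mem_univ _⟩)

omit [DecidableEq G] in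
/-- … and sums to one. -/
private theorem gibbs_sum' [Nonempty G] (hw : ∀ U, 0 < w U) : ∑ U, w U / ∑ V, w V = 1 := by
  rw [← sum_div]
  exact div_self (sum_pos (fun V _ => hw V) univ_nonempty).ne'

/-- Uniform link selection sums to one. -/
private theorem uniform_sum' [NeZero n] : ∑ _ℓ : Fin n, (n : ℝ)⁻¹ = 1 := by
  rw [sum_const, card_univ, Fintype.card_fin, nsmul_eq_mul]
  exact mul_inv_cancel₀ (Nat.cast_ne_zero.mpr (NeZero.ne n))

/-- **Non-negative autocovariances**: `C_f(k) = ⟨f̄, P_HBᵏ f̄⟩_p ≥ 0` for every observable `f` and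
every lag `k`. -/
theorem heatBath_autocov_nonneg (hw : ∀ U, 0 < w U) (k : ℕ) (f : (Fin n → G) → ℝ) :
    0 ≤ piInner (fun U => w U / ∑ V, w V) (centred (fun U => w U / ∑ V, w V) f)
      (randomScanGibbs (fun _ : Fin n => (n : ℝ)⁻¹) (fun U => w U / ∑ V, w V) ^ k
        *ᵥ centred (fun U => w U / ∑ V, w V) f) :=
  Liu2001_thm_6_6_2_nonneg (fun _ => inv_nonneg.mpr (Nat.cast_nonneg n)) (gibbs_pos' hw) k f

/-- **Non-increasing autocovariances**: `C_f(k+1) ≤ C_f(k)`. -/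
theorem heatBath_autocov_antitone [NeZero n] (hw : ∀ U, 0 < w U) (f : (Fin n → G) → ℝ) (k : ℕ) :
    piInner (fun U => w U / ∑ V, w V) (centred (fun U => w U / ∑ V, w V) f)
        (randomScanGibbs (fun _ : Fin n => (n : ℝ)⁻¹) (fun U => w U / ∑ V, w V) ^ (k + 1)
          *ᵥ centred (fun U => w U / ∑ V, w V) f)
      ≤ piInner (fun U => w U / ∑ V, w V) (centred (fun U => w U / ∑ V, w V) f)
        (randomScanGibbs (fun _ : Fin n => (n : ℝ)⁻¹) (fun U => w U / ∑ V, w V) ^ k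
          *ᵥ centred (fun U => w U / ∑ V, w V) f) :=
  Liu2001_thm_6_6_2_antitone (fun _ => inv_nonneg.mpr (Nat.cast_nonneg n)) uniform_sum'
    (gibbs_pos' hw) f k

/-- **No negative eigenvalue**: every real eigenvalue of the random-link heat-bath matrix is `≥ 0`. -/
theorem heatBath_eigenvalue_nonneg (hw : ∀ U, 0 < w U) {φ : (Fin n → G) → ℝ} {lam : ℝ}
    (hφ : φ ≠ 0)
    (heig : randomScanGibbs (fun _ : Fin n => (n : ℝ)⁻¹) (fun U => w U / ∑ V, w V) *ᵥ φ = lam • φ) :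
    0 ≤ lam :=
  randomScanGibbs_eigenvalue_nonneg (fun _ => inv_nonneg.mpr (Nat.cast_nonneg n)) (gibbs_pos' hw)
    hφ heig

/-- **Random-link heat bath never beats independent sampling**: `var_p(f) ≤ v(f, p, P_HB)` for every
observable `f` (`n ≥ 1` links, finite `G`, any positive Boltzmann weight). -/
theorem var_le_asympVar_heatBath [NeZero n] [Nonempty G] (hw : ∀ U, 0 < w U)
    (f : (Fin n → G) → ℝ) :
    piInner (fun U => w U / ∑ V, w V) f f - (∑ U, w U / (∑ V, w V) * f U) ^ 2
      ≤ asympVar f (fun U => w U / ∑ V, w V)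
        (randomScanGibbs (fun _ : Fin n => (n : ℝ)⁻¹) (fun U => w U / ∑ V, w V)) :=
  var_le_asympVar_randomScanGibbs
    (fun _ => inv_pos.mpr (Nat.cast_pos.mpr (Nat.pos_of_ne_zero (NeZero.ne n)))) uniform_sum'
    (gibbs_pos' hw) (gibbs_sum' hw) f

end Summit.Ventures.LatticeQCDFlow.Scoring
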